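import Mathlib
import Literature.NumberTheory.Irrationality.Lai2025TwoAdic.RationalFunctionB
import Literature.NumberTheory.Irrationality.PAdicZetaValues.VolkenbornDeltaOperator
import Literature.NumberTheory.Irrationality.PAdicZetaValues.HurwitzLemma27TwoProofs
import Literature.Algebra.Module.LocalGlobalLattice
import Literature.NumberTheory.Transcendental.ZudilinLemma19
import HarnessLib

/-!
# Lai 2025 (IJNT, `2`-adic zeta values), §3–§5 at `s = 0`: the linear forms
# `T_n = ∫_{ℤ₂} B_n(t+¼)dt = σ_{n,0} + σ_{n,2}·ζ₂(3,¼)` (Lemma 3.3), `σ_{n,2} ∈ ℤ`, `d_n³σ_{n,0} ∈ ℤ`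
# (Lemmas 4.5–4.6) and `|σ_{n,i}| ≤ n^{O(1)}·2^{6n}` (Lemma 5.2) — PROVED

Topic `Literature/NumberTheory/Irrationality/Lai2025TwoAdic`.  Source: L. Lai, *On the irrationality of certain
`2`-adic zeta values*, Int. J. Number Theory (2025) = arXiv:2304.00816 [Lai2025TwoAdicZeta] (held text
`paper:arxiv-2304.00816`, chunks p0007–p0010 = §§3–5, read on the page).  PROOF FILE (definitions with bodies +
theorems; no named fact, net debt 0); file 2 of the tree's discharge of [Calegari2005, Thm 3.3] (`ζ₂(3) ∉ ℚ`) along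
the printed alternative proof [Lai2025TwoAdicZeta, Thm 1.3 at `s = 0`].  Companion of `RationalFunctionB.lean`
(`B n`, `coeffB n i k = b_{n,i,k}`, `B_eq_sum_coeffB`, Lemma 4.2).

## Source, as printed (`s = 0` throughout, so `s + 2 = 2`)

* **Definition 3.2.** «`T_n := ∫_{ℤ₂} B_n^{(s)}(t + ¼) dt ∈ ℚ₂`.»
* **Lemma 3.3.** «`T_n = σ_{n,0} + Σ_{i=2}^{s+2} σ_{n,i} ζ₂(i+s+1, ¼)`, where
  `σ_{n,0} = (−1)^{s+1} Σ_{i=1}^{s+2}Σ_{k=1}^{n}Σ_{ℓ=0}^{k−1} (i)_{s+1} b_{n,i,k}/(ℓ+¼)^{i+s+1} ∈ ℚ`,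
  `σ_{n,i} = (−1)^s (i)_{s+1} 4^{i+s} Σ_{k=0}^{n} b_{n,i,k} ∈ ℚ (1 ≤ i ≤ s+2)`.  *Proof.* … Lemma 2.2 [the translation
  formula `∫f(t+k) = ∫f + Σ_{ℓ<k} f′(ℓ)`] … Lemma 2.6 [`∫_{ℤ₂} dt/(t+¼)^j = j4^j·ζ₂(j+1,¼)`] … we have `σ_{n,1} = 0` since
  `deg B_n(t) ≤ −2`.»
* **Lemma 4.5.** «`d_n^{s+2−i}σ_{n,i} ∈ ℤ (1 ≤ i ≤ s+2)`.»  **Lemma 4.6.** «`d_n^{2s+3}σ_{n,0} ∈ ℤ`.  *Proof.* … The key point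
  is that `B_n^{(s+1)}(t)` has roots `−1+¼, −2+¼, …, −n+¼`» (and, as for `ρ_{n,0}`: if some term were not integral
  at a prime `q`, the root relation at `t = −k₀+ℓ₀+¼` would give `k₁ ≠ k₀` with `v_q(ℓ₀+¼) > v_q(d_n)`,
  `v_q(−k₀+ℓ₀+k₁+¼) > v_q(d_n)`, hence `v_q(k₁−k₀) > v_q(d_n)`, «But this contradicts `0 < |−k₀+k₁| ≤ n`»).
* **Lemma 5.2.** «`max_{0≤i≤s+2} |σ_{n,i}| ≤ 2^{(3s+6+o(1))n}`.»

## What is formalised (all PROVED)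

* `sum_coeffB_one_eq_zero` — `σ_{n,1} = 0`, i.e. `Σ_k b_{n,1,k} = 0` (as printed: `lim_{t→∞} tB_n(t) = 0` from
  `deg B_n = −2`, while `t·Σ b_{n,i,k}(t+k)^{−i} → Σ_k b_{n,1,k}`).
* `sigma0 n`, `sigma2 n` — `σ_{n,0}`, `σ_{n,2}` of Lemma 3.3 at `s = 0` (`σ_{n,2} = 32Σ_k b_{n,2,k}`).
* `DB n : ℤ₂ → ℚ₂` — the integrand `B_n(t+¼)` of Definition 3.2 written through (def_b), `DB_natCast` (its value at a
  natural `m` is the rational number `B_n(m+¼)`); **Definition 3.2** `T n := ∫_{ℤ₂} DB n`;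
  `tendsto_volkenbornSum_quarter_shift_zpow_neg` (Lemma 2.2 + Lemma 2.6 for the translates:
  `∫(t+c+¼)^{−(k+1)} = (k+1)4^{k+1}ζ₂(k+2,¼) − (k+1)Σ_{ℓ<c}(ℓ+¼)^{−(k+2)}`, with `ζ₂(·,¼)` the TREE's `padicHurwitzZeta 2`
  and Lemma 2.6 in the tree form `padicHurwitzZeta_two_inv_four_eq`); **Lemma 3.3** `tendsto_volkenbornSum_DB`, `T_eq`:
  `T_n = σ_{n,0} + σ_{n,2}·ζ₂(3,¼)`.
* **Lemma 4.5** `exists_int_sigma2` (`σ_{n,2} ∈ ℤ`); the root relation `sum_Xterm_root_eq_zero` (`B_n′(¼−m) = 0`,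
  `1 ≤ m ≤ n`, read through (def_b)); **Lemma 4.6** `exists_int_lcm_pow_mul_sigma0` (`d_n³σ_{n,0} ∈ ℤ`), proved prime by
  prime exactly as printed (`padicNorm`; a rational which is `q`-integral at every prime is an integer).
* **Lemma 5.2 at `s = 0`**: `abs_sigma2_le` (`|σ_{n,2}| ≤ 32(n+1)2^{6n}`), `abs_sigma0_le`
  (`|σ_{n,0}| ≤ (n+1)²(160n+128)·2^{6n}`) from the coefficient bounds of `RationalFunctionB.lean`.

Cell zeta5-irr / pub-zeta5 (HONEST FRAMING: systematic search; no irrationality claim unless kernel-certified):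
`2`-adic linear forms in `1, ζ₂(3,¼)`; nothing here bears on `ζ(5) ∈ ℝ`.
-/

noncomputable section

open Finset Filter Topology
open Literature.Analysis.Calculus
open Literature.NumberTheory.LocalFields
open Literature.NumberTheory.Transcendental
open Literature.NumberTheory.Irrationality.PAdicZetaValues
open scoped Nat

namespace Literature.NumberTheory.Irrationality.Lai2025TwoAdic

/-! ## §1. `σ_{n,1} = 0`: `Σ_k b_{n,1,k} = lim_{t→∞} tB_n(t) = 0` (deg `B_n = −2`) -/

/-- `0 ≤ B_n(N)` and `B_n(N) ≤ 2^{6n}/N²` for a natural number `N ≥ 1` (each factor `N+¾+j ≤ N+1+j`; in `ℝ`).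
[cite: Lai2025TwoAdicZeta, Definition 3.1 (deg B_n ≤ −2)] -/
theorem B_natCast_bounds (n : ℕ) {N : ℕ} (hN : 1 ≤ N) :
    0 ≤ (B n N : ℝ) ∧ (B n N : ℝ) ≤ 2 ^ (6 * n) / (N : ℝ) ^ 2 := by
  have hN0 : (0 : ℝ) < N := by exact_mod_cast hN
  have hcast : (B n N : ℝ) = 2 ^ (6 * n) * (∏ j ∈ range n, ((N : ℝ) + 3 / 4 + j)) ^ 2 /
      (∏ j ∈ range (n + 1), ((N : ℝ) + j)) ^ 2 := by
    rw [B]; push_cast; ring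
  have hA0 : 0 ≤ ∏ j ∈ range n, ((N : ℝ) + 3 / 4 + j) := prod_nonneg fun j _ => by positivity
  have hB : ∏ j ∈ range (n + 1), ((N : ℝ) + j) = N * ∏ j ∈ range n, ((N : ℝ) + 1 + j) := by
    rw [Finset.prod_range_succ']
    push_cast
    rw [add_zero, mul_comm]
    congr 1
    exact prod_congr rfl fun j _ => by ring
  have hC0 : 0 < ∏ j ∈ range n, ((N : ℝ) + 1 + j) := prod_pos fun j _ => by positivity
  have hAC : ∏ j ∈ range n, ((N : ℝ) + 3 / 4 + j) ≤ ∏ j ∈ range n, ((N : ℝ) + 1 + j) :=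
    prod_le_prod (fun j _ => by positivity) fun j _ => by linarith
  rw [hcast, hB]
  constructor
  · positivity
  · rw [mul_pow, div_le_div_iff₀ (by positivity) (by positivity)]
    have h4 : (∏ j ∈ range n, ((N : ℝ) + 3 / 4 + j)) ^ 2 ≤ (∏ j ∈ range n, ((N : ℝ) + 1 + j)) ^ 2 :=
      pow_le_pow_left₀ hA0 hAC 2
    calc 2 ^ (6 * n) * (∏ j ∈ range n, ((N : ℝ) + 3 / 4 + j)) ^ 2 * (N : ℝ) ^ 2
        ≤ 2 ^ (6 * n) * (∏ j ∈ range n, ((N : ℝ) + 1 + j)) ^ 2 * (N : ℝ) ^ 2 := by gcongr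
      _ = 2 ^ (6 * n) * ((N : ℝ) ^ 2 * (∏ j ∈ range n, ((N : ℝ) + 1 + j)) ^ 2) := by ring

/-- `N·B_n(N) → 0` as `N → ∞` ("`σ_{n,1} = 0` since `deg B_n ≤ −2`"). [cite: Lai2025TwoAdicZeta, Lemma 3.3 (proof, last paragraph)] -/
private theorem tendsto_natCast_mul_B (n : ℕ) : Tendsto (fun N : ℕ => (N : ℝ) * (B n N : ℝ)) atTop (𝓝 0) := by
  have hup : Tendsto (fun N : ℕ => (2 : ℝ) ^ (6 * n) / (N : ℝ)) atTop (𝓝 0) :=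
    tendsto_const_div_atTop_nhds_zero_nat _
  refine squeeze_zero' ?_ ?_ hup
  · filter_upwards [eventually_ge_atTop 1] with N hN
    exact mul_nonneg (Nat.cast_nonneg N) (B_natCast_bounds n hN).1
  · filter_upwards [eventually_ge_atTop 1] with N hN
    have hN0 : (0 : ℝ) < N := by exact_mod_cast hN
    have h := (B_natCast_bounds n hN).2
    calc (N : ℝ) * (B n N : ℝ) ≤ N * (2 ^ (6 * n) / (N : ℝ) ^ 2) := mul_le_mul_of_nonneg_left h hN0.le
      _ = 2 ^ (6 * n) / (N : ℝ) := by field_simp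

/-- **`σ_{n,1} = 0`**, i.e. `Σ_{k=0}^{n} b_{n,1,k} = 0` («since `deg B_n(t) ≤ −2`»: `Σ_k b_{n,1,k} = lim_{t→∞} tB_n(t) = 0`).
[cite: Lai2025TwoAdicZeta, Lemma 3.3 (proof: σ_{n,1} = 0)] -/
theorem sum_coeffB_one_eq_zero (n : ℕ) : ∑ k ∈ range (n + 1), coeffB n 1 k = 0 := by
  set L : ℕ → ℕ → ℝ := fun i k => if i = 1 then (coeffB n 1 k : ℝ) else 0 with hL
  have hterm : ∀ k ∈ range (n + 1), ∀ i ∈ (Icc 1 2 : Finset ℕ),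
      Tendsto (fun N : ℕ => (N : ℝ) * ((coeffB n i k : ℝ) * (((N : ℝ) + k) ^ i)⁻¹)) atTop (𝓝 (L i k)) := by
    intro k _ i hi
    have h1 : Tendsto (fun N : ℕ => (N : ℝ) / ((N : ℝ) + k)) atTop (𝓝 1) := tendsto_natCast_div_add_atTop (k : ℝ)
    by_cases hi' : i = 1
    · subst hi'
      simp only [hL, if_true, pow_one]
      have := h1.const_mul (coeffB n 1 k : ℝ)
      rw [mul_one] at this
      refine this.congr fun N => ?_
      ring
    · simp only [hL, if_neg hi']
      have hi2 : i = 2 := by have := mem_Icc.1 hi; omega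
      subst hi2
      have h2 : Tendsto (fun N : ℕ => (((N : ℝ) + k) ^ 1)⁻¹) atTop (𝓝 0) := by
        have ht : Tendsto (fun N : ℕ => ((N : ℝ) + k) ^ 1) atTop atTop := by
          refine (tendsto_pow_atTop (by omega)).comp ?_
          exact tendsto_atTop_add_const_right _ _ tendsto_natCast_atTop_atTop
        exact ht.inv_tendsto_atTop
      have h := (h1.mul h2).const_mul (coeffB n 2 k : ℝ)
      rw [one_mul, mul_zero] at h
      refine h.congr' ?_
      filter_upwards [eventually_ge_atTop 1] with N hN
      have hNk : ((N : ℝ) + k) ≠ 0 := by positivity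
      field_simp
  have hsum : Tendsto (fun N : ℕ => (N : ℝ) * ∑ k ∈ range (n + 1), ∑ i ∈ (Icc 1 2 : Finset ℕ),
      (coeffB n i k : ℝ) * (((N : ℝ) + k) ^ i)⁻¹) atTop
      (𝓝 (∑ k ∈ range (n + 1), ∑ i ∈ (Icc 1 2 : Finset ℕ), L i k)) := by
    have h := tendsto_finsetSum (range (n + 1)) fun k hk =>
      tendsto_finsetSum (Icc 1 2 : Finset ℕ) fun i hi => hterm k hk i hi
    refine h.congr fun N => ?_
    rw [mul_sum]
    exact sum_congr rfl fun k _ => by rw [mul_sum]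
  have hLsum : ∑ k ∈ range (n + 1), ∑ i ∈ (Icc 1 2 : Finset ℕ), L i k =
      ((∑ k ∈ range (n + 1), coeffB n 1 k : ℚ) : ℝ) := by
    push_cast
    refine sum_congr rfl fun k _ => ?_
    rw [show (Icc 1 2 : Finset ℕ) = {1, 2} by decide]
    simp [hL]
  have heq : ∀ᶠ N : ℕ in atTop, (N : ℝ) * (B n N : ℝ) =
      (N : ℝ) * ∑ k ∈ range (n + 1), ∑ i ∈ (Icc 1 2 : Finset ℕ), (coeffB n i k : ℝ) * (((N : ℝ) + k) ^ i)⁻¹ := by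
    filter_upwards [eventually_ge_atTop 1] with N hN
    have hne : ∀ j ∈ range (n + 1), (N : ℚ) + j ≠ 0 := fun j _ => by positivity
    rw [B_eq_sum_coeffB n hne]
    push_cast
    rfl
  have hlim := (tendsto_natCast_mul_B n).congr' heq
  have huniq := tendsto_nhds_unique hlim hsum
  rw [hLsum] at huniq
  exact_mod_cast huniq.symm

/-! ## §2. The coefficients `σ_{n,0}`, `σ_{n,2}` of Lemma 3.3 (`s = 0`) -/

/-- The inner sum `X_{n,k}(y) := Σ_{i=1}^{2} i·b_{n,i,k}·y^{−(i+1)}` (so that `σ_{n,0} = −Σ_{k}Σ_{ℓ<k} X_{n,k}(ℓ+¼)` and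
`−B_n′(t) = Σ_k X_{n,k}(t+k)`). [cite: Lai2025TwoAdicZeta, Lemma 3.3 (def. of σ_{n,0}) and Lemma 4.6 (proof)] -/
def Xterm (n k : ℕ) (y : ℚ) : ℚ :=
  ∑ i ∈ (Icc 1 2 : Finset ℕ), (i : ℚ) * coeffB n i k * (y ^ (i + 1))⁻¹

/-- **`σ_{n,0}`** at `s = 0`: `σ_{n,0} = −Σ_{i=1}^{2}Σ_{k=1}^{n}Σ_{ℓ=0}^{k−1} i·b_{n,i,k}/(ℓ+¼)^{i+1}` (the `k = 0` term is an
empty sum). [cite: Lai2025TwoAdicZeta, Lemma 3.3 (σ_{n,0})] -/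
def sigma0 (n : ℕ) : ℚ :=
  -∑ k ∈ range (n + 1), ∑ ℓ ∈ range k, Xterm n k ((ℓ : ℚ) + 1 / 4)

/-- **`σ_{n,2}`** at `s = 0`: `σ_{n,2} = (2)_1·4²·Σ_{k=0}^{n} b_{n,2,k} = 32 Σ_k b_{n,2,k}`. [cite: Lai2025TwoAdicZeta, Lemma 3.3 (σ_{n,i}, i = s+2)] -/
def sigma2 (n : ℕ) : ℚ := 32 * ∑ k ∈ range (n + 1), coeffB n 2 k

/-- Unfolding of `σ_{n,0}` as a triple sum. [cite: Lai2025TwoAdicZeta, Lemma 3.3 (σ_{n,0})] -/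
theorem sigma0_eq (n : ℕ) : sigma0 n = -∑ k ∈ range (n + 1), ∑ ℓ ∈ range k, ∑ i ∈ (Icc 1 2 : Finset ℕ),
    (i : ℚ) * coeffB n i k * ((((ℓ : ℚ) + 1 / 4)) ^ (i + 1))⁻¹ := by
  rw [sigma0]; rfl

/-! ## §3. Definition 3.2: the integrand `B_n(t+¼)` through (def_b), and `T_n` -/

/-- The `2`-adic integrand `B_n(t+¼)` of Definition 3.2, written through the partial fractions (def_b):
`Σ_{k ≤ n}Σ_{i=1}^{2} b_{n,i,k}(t+k+¼)^{−i}` (`t ∈ ℤ₂`; no pole on `ℤ₂` since `‖¼‖₂ = 4`). [cite: Lai2025TwoAdicZeta, Definition 3.2 (T_n) with Definition 3.1 (def_b)] -/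
def DB (n : ℕ) (t : ℤ_[2]) : ℚ_[2] :=
  ∑ k ∈ range (n + 1), ∑ i ∈ (Icc 1 2 : Finset ℕ),
    ((coeffB n i k : ℚ) : ℚ_[2]) * ((t : ℚ_[2]) + k + 1 / 4) ^ (-(i : ℤ))

/-- The same expression over `ℚ`. [cite: Lai2025TwoAdicZeta, Definition 3.2 with (def_b)] -/
def DBq (n : ℕ) (x : ℚ) : ℚ :=
  ∑ k ∈ range (n + 1), ∑ i ∈ (Icc 1 2 : Finset ℕ), coeffB n i k * ((x + k + 1 / 4) ^ i)⁻¹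

/-- At natural numbers the `2`-adic integrand is the rational number `DBq n m` (cast compatibility).
[cite: Lai2025TwoAdicZeta, Definition 3.2] -/
theorem DB_natCast (n m : ℕ) : DB n (m : ℤ_[2]) = ((DBq n m : ℚ) : ℚ_[2]) := by
  rw [DB, DBq]
  push_cast
  refine sum_congr rfl fun k _ => sum_congr rfl fun i _ => ?_
  rw [zpow_neg, zpow_natCast]

/-- `m + ¼` is never a pole: `m + ¼ + j ≠ 0`. [cite: Lai2025TwoAdicZeta, §2.3 (|¼|₂ = 4 = q₂: t + ¼ has no zero on ℤ₂)] -/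
theorem natCast_add_quarter_add_ne_zero (m j : ℕ) : (m : ℚ) + 1 / 4 + j ≠ 0 := by positivity

/-- `DBq n m = B_n(m + ¼)` at every natural `m` (the expansion (def_b) at the non-pole `m + ¼`).
[cite: Lai2025TwoAdicZeta, Definition 3.2 with (def_b)] -/
theorem DBq_natCast_eq_B (n m : ℕ) : DBq n m = B n ((m : ℚ) + 1 / 4) := by
  rw [B_eq_sum_coeffB n (fun j _ => natCast_add_quarter_add_ne_zero m j), DBq]
  refine sum_congr rfl fun k _ => sum_congr rfl fun i _ => ?_
  ring_nf

/-- **Definition 3.2** (`s = 0`): `T_n := ∫_{ℤ₂} B_n(t+¼) dt` (tree `volkenbornIntegral`; the Riemann sums converge,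
`tendsto_volkenbornSum_DB`). [cite: Lai2025TwoAdicZeta, Definition 3.2 (T_n)] -/
def T (n : ℕ) : ℚ_[2] := volkenbornIntegral 2 (DB n)

/-! ## §4. Lemma 2.6 at `x = ¼` and its translates (Lemma 2.2) -/

/-- `‖¼‖₂ = 4 > 1`. [cite: Lai2025TwoAdicZeta, §2.3 (|x|_p ≥ q_p at x = ¼)] -/
theorem one_lt_norm_quarter : 1 < ‖(1 / 4 : ℚ_[2])‖ := by
  rw [one_div, norm_inv_four]; norm_num

/-- `ℓ + ¼ ≠ 0` in `ℚ₂` and `‖ℓ + ¼‖₂ = 4`. [cite: Lai2025TwoAdicZeta, §2.3] -/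
theorem norm_natCast_add_quarter (ℓ : ℕ) : ‖(ℓ : ℚ_[2]) + 1 / 4‖ = 4 := by
  have h4 : ‖(1 / 4 : ℚ_[2])‖ = 4 := by rw [one_div, norm_inv_four]
  have hm : ‖(ℓ : ℚ_[2])‖ ≤ 1 := by
    have h := Padic.norm_int_le_one (p := 2) (ℓ : ℤ)
    rwa [Int.cast_natCast] at h
  have hne : ‖(1 / 4 : ℚ_[2])‖ ≠ ‖(ℓ : ℚ_[2])‖ := by rw [h4]; exact ne_of_gt (hm.trans_lt (by norm_num))
  rw [add_comm, Padic.add_eq_max_of_ne hne, h4, max_eq_left (hm.trans (by norm_num))]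

/-- **Lemma 2.6 at `x = ¼`** (`∫_{ℤ₂} dt/(t+¼)^j = j4^j ζ₂(j+1,¼)`, here `j = k+1`): the Riemann sums of `(t+¼)^{−(k+1)}`
tend to `(k+1)·4^{k+1}·ζ₂(k+2, ¼)`, with `ζ₂(·,¼)` the TREE's `padicHurwitzZeta 2 · 4⁻¹` (tree form of the definition:
`padicHurwitzZeta_two_inv_four_eq`, `ω(¼) = ¼`). [cite: Lai2025TwoAdicZeta, Lemma 2.6 (the display for x = ¼)] -/
theorem tendsto_volkenbornSum_quarter_zpow_neg (k : ℕ) :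
    Tendsto (volkenbornSum 2 (fun t : ℤ_[2] => ((t : ℚ_[2]) + 1 / 4) ^ (-((k : ℤ) + 1)))) atTop
      (𝓝 (((k : ℚ_[2]) + 1) * 4 ^ (k + 1) * padicHurwitzZeta 2 (k + 2) (4 : ℚ_[2])⁻¹)) := by
  -- the limit `W` of the Riemann sums of `(1 + 4t)^{−(k+1)}`
  obtain ⟨W, hW0⟩ := exists_tendsto_volkenbornSum_unitClass_four (a := 1) (by norm_num) k
  set g : ℤ_[2] → ℚ_[2] := fun t => ((1 : ℚ_[2]) + 4 * (t : ℚ_[2])) ^ (-((k : ℤ) + 1)) with hg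
  have hfg : (fun t : ℤ_[2] => (((1 : ℕ) : ℚ_[2]) + ((2 ^ (1 + 1) : ℕ) : ℚ_[2]) * (t : ℚ_[2])) ^ (-((k : ℤ) + 1))) = g := by
    funext t
    simp only [hg]
    push_cast
    norm_num
  rw [hfg] at hW0
  have h21 : (k + 2) - 1 = k + 1 := by omega
  have hW' : Tendsto (volkenbornSum 2 (fun t : ℤ_[2] => ((1 : ℚ_[2]) + 4 * (t : ℚ_[2])) ^ (-(((k + 2) - 1 : ℕ) : ℤ))))
      atTop (𝓝 W) := by
    rw [h21]
    have e : (-((k + 1 : ℕ) : ℤ)) = -((k : ℤ) + 1) := by push_cast; ring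
    simp_rw [e]
    exact hW0
  have hζ := padicHurwitzZeta_two_inv_four_eq (j := k + 2) (by omega) hW'
  -- `(t + ¼)^{−(k+1)} = 4^{k+1} · (1 + 4t)^{−(k+1)}`
  have h40 : (4 : ℚ_[2]) ≠ 0 := by norm_num
  have hfun : (fun t : ℤ_[2] => ((t : ℚ_[2]) + 1 / 4) ^ (-((k : ℤ) + 1))) =
      fun t : ℤ_[2] => (4 : ℚ_[2]) ^ ((k : ℤ) + 1) • g t := by
    funext t
    simp only [hg, smul_eq_mul]
    have e : ((t : ℚ_[2]) + 1 / 4) = (4 : ℚ_[2])⁻¹ * (1 + 4 * (t : ℚ_[2])) := by field_simp; ring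
    rw [e, mul_zpow, inv_zpow', neg_neg]
  have hours : Tendsto (volkenbornSum 2 (fun t : ℤ_[2] => ((t : ℚ_[2]) + 1 / 4) ^ (-((k : ℤ) + 1)))) atTop
      (𝓝 ((4 : ℚ_[2]) ^ ((k : ℤ) + 1) * W)) := by
    rw [hfun]
    refine (hW0.const_mul ((4 : ℚ_[2]) ^ ((k : ℤ) + 1))).congr fun r => ?_
    rw [volkenbornSum_smul, smul_eq_mul]
  have hval : (4 : ℚ_[2]) ^ ((k : ℤ) + 1) * W = ((k : ℚ_[2]) + 1) * 4 ^ (k + 1) * padicHurwitzZeta 2 (k + 2) (4 : ℚ_[2])⁻¹ := by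
    rw [hζ]
    have hk1 : (((k + 2 : ℕ) : ℚ_[2]) - 1) = (k : ℚ_[2]) + 1 := by push_cast; ring
    rw [hk1, zpow_add_one₀ h40, zpow_natCast]
    have hk0 : ((k : ℚ_[2]) + 1) ≠ 0 := by exact_mod_cast (Nat.cast_add_one_ne_zero k : ((k : ℚ_[2]) + 1) ≠ 0)
    field_simp
    ring
  rw [← hval]
  exact hours

/-- **Lemma 2.6 for the translates** (with Lemma 2.2): for `c ∈ ℕ`, the Riemann sums of `(t+c+¼)^{−(k+1)}` tend to
`(k+1)4^{k+1}ζ₂(k+2,¼) − (k+1)Σ_{ℓ<c}(ℓ+¼)^{−(k+2)}` (`∫f(t+c) = ∫f + Σ_{ℓ<c}f′(ℓ)` with `f(t) = (t+¼)^{−(k+1)}`).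
[cite: Lai2025TwoAdicZeta, Lemma 3.3 (proof: Lemma 2.2 then Lemma 2.6)] -/
theorem tendsto_volkenbornSum_quarter_shift_zpow_neg (k c : ℕ) :
    Tendsto (volkenbornSum 2 (fun t : ℤ_[2] => ((t : ℚ_[2]) + c + 1 / 4) ^ (-((k : ℤ) + 1)))) atTop
      (𝓝 (((k : ℚ_[2]) + 1) * 4 ^ (k + 1) * padicHurwitzZeta 2 (k + 2) (4 : ℚ_[2])⁻¹ +
        ∑ ℓ ∈ range c, -((k : ℚ_[2]) + 1) * (((ℓ : ℚ_[2]) + 1 / 4) ^ (k + 2))⁻¹)) := by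
  set f : ℤ_[2] → ℚ_[2] := fun t => ((t : ℚ_[2]) + 1 / 4) ^ (-((k : ℤ) + 1)) with hf
  have hI := tendsto_volkenbornSum_quarter_zpow_neg k
  have h := tendsto_volkenbornSum_shift_nat (p := 2) (f := f)
    (D := fun ℓ => -((k : ℚ_[2]) + 1) * (((ℓ : ℚ_[2]) + 1 / 4) ^ (k + 2))⁻¹) c hI ?_
  · have hfun : (fun t : ℤ_[2] => f (t + (c : ℤ_[2]))) = fun t : ℤ_[2] => ((t : ℚ_[2]) + c + 1 / 4) ^ (-((k : ℤ) + 1)) := by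
      funext t
      simp only [hf, PadicInt.coe_add, PadicInt.coe_natCast]
    rw [hfun] at h
    exact h
  intro ℓ _
  have hx₀0 : ((ℓ : ℚ_[2]) + 1 / 4) ≠ 0 := by
    intro h0
    have := norm_natCast_add_quarter ℓ
    rw [h0, norm_zero] at this
    norm_num at this
  have hderiv : HasDerivAt (fun x : ℚ_[2] => x ^ (-((k : ℤ) + 1)))
      ((((-((k : ℤ) + 1) : ℤ)) : ℚ_[2]) * ((ℓ : ℚ_[2]) + 1 / 4) ^ ((-((k : ℤ) + 1)) - 1)) ((ℓ : ℚ_[2]) + 1 / 4) :=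
    hasDerivAt_zpow (-((k : ℤ) + 1)) _ (Or.inl hx₀0)
  have hlim := tendsto_pow_inv_smul_sub_of_hasDerivAt (p := 2) hderiv
  have hval : (((-((k : ℤ) + 1) : ℤ)) : ℚ_[2]) * ((ℓ : ℚ_[2]) + 1 / 4) ^ ((-((k : ℤ) + 1)) - 1) =
      -((k : ℚ_[2]) + 1) * (((ℓ : ℚ_[2]) + 1 / 4) ^ (k + 2))⁻¹ := by
    rw [show (-((k : ℤ) + 1)) - 1 = -((k + 2 : ℕ) : ℤ) by push_cast; ring, zpow_neg, zpow_natCast]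
    push_cast
    ring
  rw [hval] at hlim
  refine hlim.congr fun r => ?_
  simp only [hf, PadicInt.coe_add, PadicInt.coe_natCast]
  push_cast
  ring_nf

/-! ## §5. Lemma 3.3: `T_n = σ_{n,0} + σ_{n,2}·ζ₂(3,¼)` -/

/-- The Riemann sums of `DB n` as the combination of those of `(t+k+¼)^{−i}`. [cite: Lai2025TwoAdicZeta, Lemma 3.3 (proof, first display)] -/
theorem volkenbornSum_DB (n N : ℕ) : volkenbornSum 2 (DB n) N =
    ∑ k ∈ range (n + 1), ∑ i ∈ (Icc 1 2 : Finset ℕ), ((coeffB n i k : ℚ) : ℚ_[2]) *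
      volkenbornSum 2 (fun t : ℤ_[2] => ((t : ℚ_[2]) + k + 1 / 4) ^ (-(i : ℤ))) N := by
  set f : ℕ → ℕ → ℤ_[2] → ℚ_[2] := fun i k t => ((t : ℚ_[2]) + k + 1 / 4) ^ (-(i : ℤ)) with hf
  set G : ℕ → ℤ_[2] → ℚ_[2] := fun k t => ∑ i ∈ (Icc 1 2 : Finset ℕ),
    (fun (i : ℕ) (t : ℤ_[2]) => ((coeffB n i k : ℚ) : ℚ_[2]) • f i k t) i t with hG
  have hD : DB n = fun t => ∑ k ∈ range (n + 1), G k t := by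
    funext t
    simp only [DB, hG, hf, smul_eq_mul]
  rw [hD, volkenbornSum_finset_sum]
  refine sum_congr rfl fun k _ => ?_
  rw [hG, volkenbornSum_finset_sum]
  refine sum_congr rfl fun i _ => ?_
  rw [volkenbornSum_smul, smul_eq_mul]

/-- **Lemma 3.3 (the limit), `s = 0`:** the Riemann sums of `B_n(t+¼)` converge `2`-adically to
`σ_{n,0} + σ_{n,2}·ζ₂(3,¼)` (termwise: `∫(t+k+¼)^{−i} = i4^iζ₂(i+1,¼) − iΣ_{ℓ<k}(ℓ+¼)^{−(i+1)}`; the `ζ₂(2,¼)` term carries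
the coefficient `σ_{n,1} = 4Σ_k b_{n,1,k} = 0`). [cite: Lai2025TwoAdicZeta, Lemma 3.3 (T_n)] -/
theorem tendsto_volkenbornSum_DB (n : ℕ) :
    Tendsto (volkenbornSum 2 (DB n)) atTop
      (𝓝 (((sigma0 n : ℚ) : ℚ_[2]) + ((sigma2 n : ℚ) : ℚ_[2]) * padicHurwitzZeta 2 3 (4 : ℚ_[2])⁻¹)) := by
  -- termwise limits, indexed by `i ≥ 1` through `i = i' + 1`
  set A : ℕ → ℚ_[2] := fun i => (i : ℚ_[2]) * 4 ^ i * padicHurwitzZeta 2 (i + 1) (4 : ℚ_[2])⁻¹ with hA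
  set Bs : ℕ → ℕ → ℚ_[2] := fun i k => ∑ ℓ ∈ range k, -(i : ℚ_[2]) * (((ℓ : ℚ_[2]) + 1 / 4) ^ (i + 1))⁻¹ with hBs
  have hterm : ∀ k : ℕ, ∀ i ∈ (Icc 1 2 : Finset ℕ),
      Tendsto (volkenbornSum 2 (fun t : ℤ_[2] => ((t : ℚ_[2]) + k + 1 / 4) ^ (-(i : ℤ)))) atTop (𝓝 (A i + Bs i k)) := by
    intro k i hi
    obtain ⟨i', rfl⟩ : ∃ i', i = i' + 1 := ⟨i - 1, by have := (mem_Icc.1 hi).1; omega⟩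
    have h := tendsto_volkenbornSum_quarter_shift_zpow_neg i' k
    have e1 : (-(((i' + 1 : ℕ)) : ℤ)) = -((i' : ℤ) + 1) := by push_cast; ring
    have hval : ((i' : ℚ_[2]) + 1) * 4 ^ (i' + 1) * padicHurwitzZeta 2 (i' + 2) (4 : ℚ_[2])⁻¹ +
        ∑ ℓ ∈ range k, -((i' : ℚ_[2]) + 1) * (((ℓ : ℚ_[2]) + 1 / 4) ^ (i' + 2))⁻¹ = A (i' + 1) + Bs (i' + 1) k := by
      simp only [hA, hBs, show i' + 1 + 1 = i' + 2 from rfl]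
      push_cast
      ring_nf
    rw [← hval]
    simp_rw [e1]
    exact h
  have hlim : Tendsto (volkenbornSum 2 (DB n)) atTop (𝓝 (∑ k ∈ range (n + 1), ∑ i ∈ (Icc 1 2 : Finset ℕ),
      ((coeffB n i k : ℚ) : ℚ_[2]) * (A i + Bs i k))) := by
    have h := tendsto_finsetSum (range (n + 1)) fun k (_ : k ∈ range (n + 1)) =>
      tendsto_finsetSum (Icc 1 2 : Finset ℕ) fun i (hi : i ∈ (Icc 1 2 : Finset ℕ)) =>
        (hterm k i hi).const_mul ((coeffB n i k : ℚ) : ℚ_[2])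
    refine h.congr fun N => ?_
    rw [volkenbornSum_DB]
  -- evaluate the limit
  have hBsum : ∑ k ∈ range (n + 1), ∑ i ∈ (Icc 1 2 : Finset ℕ), ((coeffB n i k : ℚ) : ℚ_[2]) * Bs i k =
      ((sigma0 n : ℚ) : ℚ_[2]) := by
    rw [sigma0_eq]
    push_cast
    rw [← sum_neg_distrib]
    refine sum_congr rfl fun k _ => ?_
    simp only [hBs, mul_sum]
    rw [Finset.sum_comm, ← sum_neg_distrib]
    refine sum_congr rfl fun ℓ _ => ?_
    rw [← sum_neg_distrib]
    refine sum_congr rfl fun i _ => ?_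
    ring
  have hAsum : ∑ k ∈ range (n + 1), ∑ i ∈ (Icc 1 2 : Finset ℕ), ((coeffB n i k : ℚ) : ℚ_[2]) * A i =
      ((sigma2 n : ℚ) : ℚ_[2]) * padicHurwitzZeta 2 3 (4 : ℚ_[2])⁻¹ := by
    rw [Finset.sum_comm]
    have hi : ∀ i ∈ (Icc 1 2 : Finset ℕ), ∑ k ∈ range (n + 1), ((coeffB n i k : ℚ) : ℚ_[2]) * A i =
        A i * (((∑ k ∈ range (n + 1), coeffB n i k : ℚ)) : ℚ_[2]) := by
      intro i _
      push_cast
      rw [mul_sum]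
      exact sum_congr rfl fun k _ => by ring
    rw [sum_congr rfl hi, show (Icc 1 2 : Finset ℕ) = {1, 2} by decide, sum_insert (by decide), sum_singleton,
      sum_coeffB_one_eq_zero, hA, sigma2]
    push_cast
    ring
  have hval : ∑ k ∈ range (n + 1), ∑ i ∈ (Icc 1 2 : Finset ℕ), ((coeffB n i k : ℚ) : ℚ_[2]) * (A i + Bs i k) =
      ((sigma0 n : ℚ) : ℚ_[2]) + ((sigma2 n : ℚ) : ℚ_[2]) * padicHurwitzZeta 2 3 (4 : ℚ_[2])⁻¹ := by
    rw [← hAsum, ← hBsum, add_comm, ← sum_add_distrib]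
    refine sum_congr rfl fun k _ => ?_
    rw [← sum_add_distrib]
    exact sum_congr rfl fun i _ => by ring
  rw [← hval]
  exact hlim

/-- **Lemma 3.3** (`s = 0`): `T_n = σ_{n,0} + σ_{n,2}·ζ₂(3, ¼)`, with `ζ₂(3,¼)` the tree's `padicHurwitzZeta 2 3 4⁻¹`.
[cite: Lai2025TwoAdicZeta, Lemma 3.3 (T_n)] -/
theorem T_eq (n : ℕ) :
    T n = ((sigma0 n : ℚ) : ℚ_[2]) + ((sigma2 n : ℚ) : ℚ_[2]) * padicHurwitzZeta 2 3 (4 : ℚ_[2])⁻¹ :=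
  volkenbornIntegral_eq (tendsto_volkenbornSum_DB n)

/-- The Riemann sums of `B_n(t+¼)` tend to `T_n`. [cite: Lai2025TwoAdicZeta, Definition 3.2] -/
theorem tendsto_volkenbornSum_DB_T (n : ℕ) : Tendsto (volkenbornSum 2 (DB n)) atTop (𝓝 (T n)) := by
  rw [T_eq]; exact tendsto_volkenbornSum_DB n

/-! ## §6. Lemma 4.5 (`σ_{n,2} ∈ ℤ`) and Lemma 4.6 (`d_n³σ_{n,0} ∈ ℤ`) at `s = 0` -/

/-- **Lemma 4.5** (`s = 0`, `i = 2`): `σ_{n,2} ∈ ℤ` (from `b_{n,2,k} ∈ ℤ`, Lemma 4.2). [cite: Lai2025TwoAdicZeta, Lemma 4.5 (σ_{n,i})] -/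
theorem exists_int_sigma2 (n : ℕ) : ∃ z : ℤ, sigma2 n = z := by
  have h : ∀ k ∈ range (n + 1), ∃ z : ℤ, coeffB n 2 k = z := fun k hk =>
    exists_int_coeffB_two n (by have := mem_range.1 hk; omega)
  choose! z hz using h
  refine ⟨32 * ∑ k ∈ range (n + 1), z k, ?_⟩
  rw [sigma2, sum_congr rfl hz]
  push_cast
  ring

/-! ### The root relation: `B_n′(¼ − m) = 0` for `1 ≤ m ≤ n`, read through (def_b) -/

/-- **`B_n` has a double zero at `¼ − m`** (`1 ≤ m ≤ n`; the factor `(t + ¾ + (m−1))²` of `(t+¾)_n²`), so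
`B_n′(¼ − m) = 0` («`B_n^{(s+1)}(t)` has roots `−1+¼, …, −n+¼`»). [cite: Lai2025TwoAdicZeta, Lemma 4.6 (proof, last sentence)] -/
theorem hasDerivAt_B_quarter (n : ℕ) {m : ℕ} (hm1 : 1 ≤ m) (hmn : m ≤ n) :
    HasDerivAt (B n) 0 ((1 : ℚ) / 4 - m) := by
  classical
  set t₀ : ℚ := (1 : ℚ) / 4 - m with ht₀
  have hj0 : m - 1 ∈ range n := mem_range.2 (by omega)
  -- the smooth cofactor
  set H : ℚ → ℚ := fun t => (2 : ℚ) ^ (6 * n) * (∏ j ∈ (range n).erase (m - 1), (t + 3 / 4 + j)) ^ 2 /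
    (∏ j ∈ range (n + 1), (t + j)) ^ 2 with hH
  have hfac : ∀ t : ℚ, t + 3 / 4 + ((m - 1 : ℕ) : ℚ) = t - t₀ := by
    intro t
    rw [Nat.cast_sub hm1, ht₀]; push_cast; ring
  have hform : B n = fun t => (t - t₀) ^ 2 * H t := by
    funext t
    rw [B, hH, ← mul_prod_erase (range n) (fun j => t + 3 / 4 + (j : ℚ)) hj0, hfac t]
    ring
  have hden : ∏ j ∈ range (n + 1), (t₀ + j) ≠ 0 := by
    refine prod_ne_zero_iff.2 fun j _ => ?_
    rw [ht₀]
    intro h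
    have h4 : (4 * (j : ℤ) - 4 * m + 1 : ℤ) = 0 := by
      have : (4 * (j : ℚ) - 4 * m + 1) = 0 := by linarith
      exact_mod_cast this
    omega
  have hHd : DifferentiableAt ℚ H t₀ := by
    rw [hH]
    refine DifferentiableAt.div (by fun_prop) (by fun_prop) (pow_ne_zero _ hden)
  have h1 : HasDerivAt (fun t : ℚ => (t - t₀) ^ 2) (((2 : ℕ) : ℚ) * (t₀ - t₀) ^ (2 - 1) * 1) t₀ :=
    ((hasDerivAt_id t₀).sub_const t₀).fun_pow 2
  have h := h1.mul hHd.hasDerivAt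
  rw [hform]
  refine h.congr_deriv ?_
  simp

/-- A punctured... rather full neighbourhood of a non-pole avoids all the poles `−j`, `j ≤ n`. [folklore] -/
private theorem eventually_forall_add_ne_zero (n : ℕ) {x : ℚ} (hx : ∀ j ∈ range (n + 1), x + j ≠ 0) :
    ∀ᶠ t : ℚ in 𝓝 x, ∀ j ∈ range (n + 1), t + j ≠ 0 := by
  rw [eventually_all_finset]
  intro j hj
  exact ((continuous_id.add continuous_const).continuousAt (x := x)).eventually_ne (hx j hj)

/-- **The derivative of `B_n` through (def_b)**: off the poles, `B_n′(x) = −Σ_{k ≤ n} X_{n,k}(x + k)`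
(`X_{n,k}(y) = Σ_i i·b_{n,i,k}·y^{−(i+1)}`, termwise differentiation of (def_b)).
[cite: Lai2025TwoAdicZeta, Lemma 3.3 (proof: B_n^{(s)}(t+¼) from (def_b)) and Lemma 4.6 (proof: B_n^{(s+1)})] -/
theorem hasDerivAt_B_of_coeffB (n : ℕ) {x : ℚ} (hx : ∀ j ∈ range (n + 1), x + j ≠ 0) :
    HasDerivAt (B n) (-∑ k ∈ range (n + 1), Xterm n k (x + k)) x := by
  -- `B_n` agrees with the expansion near `x`
  have heq : (fun t => ∑ k ∈ range (n + 1), ∑ i ∈ (Icc 1 2 : Finset ℕ), coeffB n i k * (t + k) ^ (-(i : ℤ)))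
      =ᶠ[𝓝 x] B n := by
    filter_upwards [eventually_forall_add_ne_zero n hx] with t ht
    rw [B_eq_sum_coeffB n ht]
    refine sum_congr rfl fun k _ => sum_congr rfl fun i _ => ?_
    rw [zpow_neg, zpow_natCast]
  -- termwise derivatives
  have hterm : ∀ k ∈ range (n + 1), ∀ i ∈ (Icc 1 2 : Finset ℕ),
      HasDerivAt (fun t : ℚ => coeffB n i k * (t + k) ^ (-(i : ℤ)))
        (coeffB n i k * ((((-(i : ℤ)) : ℤ) : ℚ) * (x + k) ^ ((-(i : ℤ)) - 1) * 1)) x := by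
    intro k hk i _
    have hxk : x + k ≠ 0 := hx k hk
    have h1 : HasDerivAt (fun t : ℚ => t + k) 1 x := (hasDerivAt_id x).add_const _
    exact ((hasDerivAt_zpow (-(i : ℤ)) (x + k) (Or.inl hxk)).comp x h1).const_mul _
  have hsum := HasDerivAt.fun_sum (u := range (n + 1)) fun k hk =>
    HasDerivAt.fun_sum (u := (Icc 1 2 : Finset ℕ)) fun i hi => hterm k hk i hi
  refine (hsum.congr_of_eventuallyEq heq.symm).congr_deriv ?_
  rw [← sum_neg_distrib]
  refine sum_congr rfl fun k hk => ?_
  rw [Xterm, ← sum_neg_distrib]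
  refine sum_congr rfl fun i _ => ?_
  rw [show (-(i : ℤ)) - 1 = -((i + 1 : ℕ) : ℤ) by push_cast; ring, zpow_neg, zpow_natCast]
  push_cast
  ring

/-- **The root relation** (`1 ≤ m ≤ n`): `Σ_{k=0}^{n} Σ_{i=1}^{2} i·b_{n,i,k}·(k − m + ¼)^{−(i+1)} = 0`, i.e.
`B_n′(¼ − m) = 0` read through (def_b). [cite: Lai2025TwoAdicZeta, Lemma 4.6 (proof: "t = −k₀+ℓ₀+¼ is a root of B_n^{(s+1)}")] -/
theorem sum_Xterm_root_eq_zero (n : ℕ) {m : ℕ} (hm1 : 1 ≤ m) (hmn : m ≤ n) :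
    ∑ k ∈ range (n + 1), Xterm n k ((1 : ℚ) / 4 - m + k) = 0 := by
  have hx : ∀ j ∈ range (n + 1), (1 : ℚ) / 4 - m + j ≠ 0 := by
    intro j _ h
    have h4 : (4 * (j : ℤ) - 4 * m + 1 : ℤ) = 0 := by
      have : (4 * (j : ℚ) - 4 * m + 1) = 0 := by linarith
      exact_mod_cast this
    omega
  have h := (hasDerivAt_B_of_coeffB n hx).unique (hasDerivAt_B_quarter n hm1 hmn)
  rwa [neg_eq_zero] at h

/-! ### Lemma 4.6, prime by prime -/

/-- `q`-integrality of one term: if `v_q(N) ≤ v_q(d_n)` (i.e. `‖d_n/N‖_q ≤ 1`) then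
`‖d_n³ · X_{n,k}(N/4)‖_q ≤ 1` (`k ≤ n`), since `d_n³·i·b_{n,i,k}·(N/4)^{−(i+1)} = i·4^{i+1}·(d_n^{2−i}b_{n,i,k})·(d_n/N)^{i+1}`
with `d_n^{2−i}b_{n,i,k} ∈ ℤ` (Lemma 4.2). [cite: Lai2025TwoAdicZeta, Lemma 4.6 (proof: "by (strong_ari) … it follows that v_q(ℓ₀+¼) > v_q(d_n)")] -/
theorem padicNorm_lcm_pow_mul_Xterm_le (q : ℕ) [Fact q.Prime] (n : ℕ) {k : ℕ} (hk : k ≤ n) {N : ℤ} (hN : N ≠ 0)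
    (hle : padicNorm q ((Nat.lcmUpto n : ℚ) / N) ≤ 1) :
    padicNorm q ((Nat.lcmUpto n : ℚ) ^ 3 * Xterm n k ((N : ℚ) / 4)) ≤ 1 := by
  set d : ℚ := (Nat.lcmUpto n : ℚ) with hd
  obtain ⟨z₁, hz₁⟩ := exists_int_lcm_pow_mul_coeffB n hk 1
  obtain ⟨z₂, hz₂⟩ := exists_int_lcm_pow_mul_coeffB n hk 2
  simp only [show 2 - 1 = 1 from rfl, pow_one, Nat.sub_self, pow_zero, one_mul] at hz₁ hz₂
  have hN' : (N : ℚ) ≠ 0 := by exact_mod_cast hN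
  have hexp : d ^ 3 * Xterm n k ((N : ℚ) / 4) =
      (16 : ℤ) * (z₁ : ℚ) * (d / N) ^ 2 + (128 : ℤ) * (z₂ : ℚ) * (d / N) ^ 3 := by
    rw [Xterm, show (Icc 1 2 : Finset ℕ) = {1, 2} by decide, sum_insert (by decide), sum_singleton, ← hz₁, ← hz₂]
    push_cast
    field_simp
    ring
  rw [hexp]
  have h1 : padicNorm q ((16 : ℤ) * (z₁ : ℚ) * (d / N) ^ 2) ≤ 1 := by
    rw [padicNorm.mul, padicNorm.mul]
    refine mul_le_one₀ (mul_le_one₀ (padicNorm.of_int _) (padicNorm.nonneg _) (padicNorm.of_int _))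
      (padicNorm.nonneg _) ?_
    rw [pow_succ, pow_one, padicNorm.mul]
    exact mul_le_one₀ hle (padicNorm.nonneg _) hle
  have h2 : padicNorm q ((128 : ℤ) * (z₂ : ℚ) * (d / N) ^ 3) ≤ 1 := by
    rw [padicNorm.mul, padicNorm.mul]
    refine mul_le_one₀ (mul_le_one₀ (padicNorm.of_int _) (padicNorm.nonneg _) (padicNorm.of_int _))
      (padicNorm.nonneg _) ?_
    rw [pow_succ, pow_succ, pow_one, padicNorm.mul, padicNorm.mul]
    exact mul_le_one₀ (mul_le_one₀ hle (padicNorm.nonneg _) hle) (padicNorm.nonneg _) hle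
  exact (padicNorm.nonarchimedean).trans (max_le h1 h2)

/-- `‖d_n‖_q = q^{−⌊log_q n⌋}`. [cite: Lai2025TwoAdicZeta, Lemma 4.6 (proof: v_q(d_n))] -/
theorem padicNorm_lcmUpto (q : ℕ) [hq : Fact q.Prime] (n : ℕ) :
    padicNorm q (Nat.lcmUpto n : ℚ) = (q : ℚ) ^ (-(Nat.log q n : ℤ)) := by
  have hd0 : (Nat.lcmUpto n : ℚ) ≠ 0 := by exact_mod_cast (Nat.lcmUpto_pos n).ne'
  rw [padicNorm.eq_zpow_of_nonzero hd0, padicValRat.of_nat, Literature.NumberTheory.Transcendental.Zudilin2004.padicValNat_lcmUpto]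

/-- If `‖d_n/N‖_q > 1` (`N ≠ 0`) then `q^{⌊log_q n⌋+1} ∣ N`, i.e. `v_q(N) > v_q(d_n)`. [cite: Lai2025TwoAdicZeta, Lemma 4.6 (proof: "v_q(ℓ₀ + ¼) > v_q(d_n)")] -/
theorem pow_log_succ_dvd_of_one_lt_padicNorm (q : ℕ) [hq : Fact q.Prime] (n : ℕ) {N : ℤ} (hN : N ≠ 0)
    (hlt : 1 < padicNorm q ((Nat.lcmUpto n : ℚ) / N)) :
    (((q ^ (Nat.log q n + 1) : ℕ)) : ℤ) ∣ N := by
  rw [padicNorm.dvd_iff_norm_le]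
  have hq1 : (1 : ℚ) < q := by exact_mod_cast hq.out.one_lt
  have hN' : (N : ℚ) ≠ 0 := by exact_mod_cast hN
  rw [padicNorm.div, padicNorm_lcmUpto, lt_div_iff₀ (by
    have := padicNorm.nonneg (p := q) (N : ℚ)
    rcases this.eq_or_lt with h | h
    · exact absurd h.symm (padicNorm.nonzero hN')
    · exact h), one_mul] at hlt
  -- `‖N‖_q = q^{−v}` with `v ≥ 0`; `q^{−v} < q^{−e}` forces `v ≥ e + 1`
  rw [padicNorm.eq_zpow_of_nonzero hN'] at hlt ⊢
  rw [zpow_lt_zpow_iff_right₀ hq1] at hlt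
  push_cast
  exact zpow_le_zpow_right₀ hq1.le (by omega)

/-- **No two bad shifts**: for `k ≠ k'` in `[0, n]` it is impossible that `q^{e+1}` (`e = ⌊log_q n⌋`) divides both
`4ℓ + 1` and `4(k' − k + ℓ) + 1` — their difference `4(k' − k)` would be divisible by the odd `q^{e+1} > n ≥ |k' − k| > 0`.
[cite: Lai2025TwoAdicZeta, Lemma 4.6 (proof: "then v_q(−k₀+k₁) > v_q(d_n). But this contradicts 0 < |−k₀+k₁| ≤ n")] -/
theorem not_dvd_both (q : ℕ) [hq : Fact q.Prime] (n : ℕ) {k k' : ℕ} (hk : k ≤ n) (hk' : k' ≤ n) (hne : k' ≠ k)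
    (ℓ : ℕ) (h1 : (((q ^ (Nat.log q n + 1) : ℕ)) : ℤ) ∣ (4 * (ℓ : ℤ) + 1))
    (h2 : (((q ^ (Nat.log q n + 1) : ℕ)) : ℤ) ∣ (4 * ((k' : ℤ) - k + ℓ) + 1)) : False := by
  set Q : ℕ := q ^ (Nat.log q n + 1) with hQ
  -- `Q` is odd, hence coprime to `4`
  have hQodd : ¬ 2 ∣ Q := by
    intro h2Q
    have : (2 : ℤ) ∣ 4 * (ℓ : ℤ) + 1 := (Int.natCast_dvd_natCast.2 h2Q).trans h1
    omega
  have hcop : IsCoprime (Q : ℤ) 4 := by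
    rw [Int.isCoprime_iff_gcd_eq_one, show (4 : ℤ) = ((4 : ℕ) : ℤ) by norm_num, Int.gcd_natCast_natCast]
    have h4 : (4 : ℕ) = 2 ^ 2 := by norm_num
    rw [h4]
    exact (Nat.Coprime.pow_right 2 ((Nat.Prime.coprime_iff_not_dvd Nat.prime_two).2 hQodd).symm)
  -- `Q ∣ 4(k' − k)`, hence `Q ∣ k' − k`
  have hdiff : (Q : ℤ) ∣ 4 * ((k' : ℤ) - k) := by
    have := dvd_sub h2 h1
    have e : (4 * ((k' : ℤ) - k + ℓ) + 1) - (4 * (ℓ : ℤ) + 1) = 4 * ((k' : ℤ) - k) := by ring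
    rwa [e] at this
  have hdvd : (Q : ℤ) ∣ ((k' : ℤ) - k) := hcop.dvd_of_dvd_mul_left hdiff
  -- size: `0 < |k' − k| ≤ n < Q`
  have hQn : n < Q := Nat.lt_pow_succ_log_self hq.out.one_lt n
  have habs := Int.le_of_dvd (by
    have : ((k' : ℤ) - k) ≠ 0 := sub_ne_zero.2 (by exact_mod_cast hne)
    exact abs_pos.2 this) ((dvd_abs _ _).2 hdvd)
  have hle : |((k' : ℤ) - k)| ≤ n := by
    rw [abs_le]; constructor <;> omega
  have : (Q : ℤ) ≤ n := habs.trans hle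
  omega

/-- **Each term of `σ_{n,0}` is `d_n³`-integral**: `d_n³ · Σ_{i} i·b_{n,i,k}(ℓ+¼)^{−(i+1)} ∈ ℤ` for `0 ≤ ℓ < k ≤ n`
— at a prime `q` with `v_q(4ℓ+1) ≤ v_q(d_n)` directly, and otherwise through the root relation at `m = k − ℓ`, all of
whose other terms are `q`-integral (no two bad shifts). [cite: Lai2025TwoAdicZeta, Lemma 4.6 (proof)] -/
theorem exists_int_lcm_pow_mul_Xterm (n : ℕ) {k ℓ : ℕ} (hk : k ≤ n) (hℓ : ℓ < k) :
    ∃ z : ℤ, (z : ℚ) = (Nat.lcmUpto n : ℚ) ^ 3 * Xterm n k ((ℓ : ℚ) + 1 / 4) := by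
  refine Literature.Algebra.Module.Rat.exists_int_eq_of_forall_padicNorm_le_one _ fun q hq => ?_
  haveI : Fact q.Prime := ⟨hq⟩
  have hN : (4 * (ℓ : ℤ) + 1 : ℤ) ≠ 0 := by omega
  have hy : ((ℓ : ℚ) + 1 / 4) = (((4 * (ℓ : ℤ) + 1 : ℤ)) : ℚ) / 4 := by push_cast; ring
  by_cases hgood : padicNorm q ((Nat.lcmUpto n : ℚ) / ((4 * (ℓ : ℤ) + 1 : ℤ) : ℚ)) ≤ 1
  · rw [hy]
    exact padicNorm_lcm_pow_mul_Xterm_le q n hk hN hgood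
  · -- the bad case: use the root relation at `m = k − ℓ`
    have hbad := pow_log_succ_dvd_of_one_lt_padicNorm q n hN (not_le.1 hgood)
    have hm1 : 1 ≤ k - ℓ := by omega
    have hmn : k - ℓ ≤ n := by omega
    have hroot := sum_Xterm_root_eq_zero n hm1 hmn
    rw [← add_sum_erase _ _ (mem_range.2 (by omega : k < n + 1))] at hroot
    have hkk : (1 : ℚ) / 4 - ((k - ℓ : ℕ) : ℚ) + k = (ℓ : ℚ) + 1 / 4 := by
      rw [Nat.cast_sub hℓ.le]; ring
    rw [hkk] at hroot
    have hX : (Nat.lcmUpto n : ℚ) ^ 3 * Xterm n k ((ℓ : ℚ) + 1 / 4) =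
        -∑ k' ∈ (range (n + 1)).erase k, (Nat.lcmUpto n : ℚ) ^ 3 * Xterm n k' ((1 : ℚ) / 4 - ((k - ℓ : ℕ) : ℚ) + k') := by
      rw [← mul_sum, ← mul_neg]
      congr 1
      linarith
    rw [hX, padicNorm.neg]
    refine padicNorm.sum_le' (fun k' hk' => ?_) zero_le_one
    have hk'k : k' ≠ k := (mem_erase.1 hk').1
    have hk'n : k' ≤ n := by have := mem_range.1 (mem_of_mem_erase hk'); omega
    have hN' : (4 * ((k' : ℤ) - k + ℓ) + 1 : ℤ) ≠ 0 := by omega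
    have hy' : (1 : ℚ) / 4 - ((k - ℓ : ℕ) : ℚ) + k' = (((4 * ((k' : ℤ) - k + ℓ) + 1 : ℤ)) : ℚ) / 4 := by
      rw [Nat.cast_sub hℓ.le]; push_cast; ring
    rw [hy']
    refine padicNorm_lcm_pow_mul_Xterm_le q n hk'n hN' ?_
    by_contra hgt
    exact not_dvd_both q n hk hk'n hk'k ℓ hbad (pow_log_succ_dvd_of_one_lt_padicNorm q n hN' (not_le.1 hgt))

/-- **Lemma 4.6 at `s = 0`: `d_n³ · σ_{n,0} ∈ ℤ`.** [cite: Lai2025TwoAdicZeta, Lemma 4.6 (sigma_0_ari)] -/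
theorem exists_int_lcm_pow_mul_sigma0 (n : ℕ) : ∃ z : ℤ, (Nat.lcmUpto n : ℚ) ^ 3 * sigma0 n = z := by
  have h : ∀ k ∈ range (n + 1), ∀ ℓ ∈ range k, ∃ z : ℤ,
      (z : ℚ) = (Nat.lcmUpto n : ℚ) ^ 3 * Xterm n k ((ℓ : ℚ) + 1 / 4) := fun k hk ℓ hℓ =>
    exists_int_lcm_pow_mul_Xterm n (by have := mem_range.1 hk; omega) (mem_range.1 hℓ)
  choose! z hz using h
  refine ⟨-∑ k ∈ range (n + 1), ∑ ℓ ∈ range k, z k ℓ, ?_⟩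
  rw [sigma0, mul_neg, mul_sum]
  push_cast
  congr 1
  refine sum_congr rfl fun k hk => ?_
  rw [mul_sum]
  exact sum_congr rfl fun ℓ hℓ => (hz k hk ℓ hℓ).symm

/-! ## §7. Lemma 5.2 at `s = 0`: `|σ_{n,2}| ≤ 32(n+1)2^{6n}`, `|σ_{n,0}| ≤ (n+1)²(160n+128)2^{6n}` -/

/-- **`|σ_{n,2}| ≤ 32(n+1)·2^{6n}`**. [cite: Lai2025TwoAdicZeta, Lemma 5.2 (sigma_est)] -/
theorem abs_sigma2_le (n : ℕ) : |sigma2 n| ≤ 32 * ((n : ℚ) + 1) * 2 ^ (6 * n) := by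
  rw [sigma2, abs_mul, show |(32 : ℚ)| = 32 by norm_num, mul_assoc]
  refine mul_le_mul_of_nonneg_left ?_ (by norm_num)
  refine (abs_sum_le_sum_abs _ _).trans ?_
  have h : ∑ k ∈ range (n + 1), |coeffB n 2 k| ≤ ∑ _k ∈ range (n + 1), (2 : ℚ) ^ (6 * n) :=
    sum_le_sum fun k hk => by
      rw [abs_of_nonneg (coeffB_two_nonneg n k)]
      exact coeffB_two_le n (by have := mem_range.1 hk; omega)
  refine h.trans ?_
  rw [sum_const, card_range, nsmul_eq_mul]
  push_cast
  rfl

/-- `|X_{n,k}(ℓ + ¼)| ≤ (160n + 128)·2^{6n}` (`(ℓ+¼)^{−2} ≤ 16`, `(ℓ+¼)^{−3} ≤ 64`). [cite: Lai2025TwoAdicZeta, Lemma 5.2 (proof: the bound for σ_{n,0})] -/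
theorem abs_Xterm_le (n : ℕ) {k : ℕ} (hk : k ≤ n) (ℓ : ℕ) :
    |Xterm n k ((ℓ : ℚ) + 1 / 4)| ≤ (160 * n + 128) * (2 : ℚ) ^ (6 * n) := by
  have hy : (1 / 4 : ℚ) ≤ (ℓ : ℚ) + 1 / 4 := by have : (0 : ℚ) ≤ ℓ := Nat.cast_nonneg ℓ; linarith
  have hy0 : (0 : ℚ) < (ℓ : ℚ) + 1 / 4 := by positivity
  have hinv : ∀ i : ℕ, (((ℓ : ℚ) + 1 / 4) ^ i)⁻¹ ≤ 4 ^ i := by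
    intro i
    rw [← inv_pow]
    refine pow_le_pow_left₀ (by positivity) ?_ i
    calc (((ℓ : ℚ) + 1 / 4))⁻¹ ≤ (1 / 4 : ℚ)⁻¹ := inv_anti₀ (by norm_num) hy
      _ = 4 := by norm_num
  rw [Xterm, show (Icc 1 2 : Finset ℕ) = {1, 2} by decide, sum_insert (by decide), sum_singleton]
  have h1 : |(((1 : ℕ) : ℚ)) * coeffB n 1 k * ((((ℓ : ℚ) + 1 / 4)) ^ (1 + 1))⁻¹| ≤ 10 * n * 2 ^ (6 * n) * 16 := by
    rw [Nat.cast_one, one_mul, abs_mul, abs_inv, abs_pow, abs_of_pos hy0]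
    exact mul_le_mul (abs_coeffB_one_le n hk) ((hinv 2).trans (by norm_num)) (by positivity) (by positivity)
  have h2 : |(((2 : ℕ) : ℚ)) * coeffB n 2 k * ((((ℓ : ℚ) + 1 / 4)) ^ (2 + 1))⁻¹| ≤ 2 * 2 ^ (6 * n) * 64 := by
    rw [abs_mul, abs_mul, abs_inv, abs_pow, abs_of_pos hy0, abs_of_nonneg (coeffB_two_nonneg n k),
      Nat.cast_ofNat, abs_two]
    exact mul_le_mul (mul_le_mul_of_nonneg_left (coeffB_two_le n hk) zero_le_two) ((hinv 3).trans (by norm_num))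
      (by positivity) (by positivity)
  calc |(((1 : ℕ) : ℚ)) * coeffB n 1 k * ((((ℓ : ℚ) + 1 / 4)) ^ (1 + 1))⁻¹ +
        (((2 : ℕ) : ℚ)) * coeffB n 2 k * ((((ℓ : ℚ) + 1 / 4)) ^ (2 + 1))⁻¹|
      ≤ 10 * n * 2 ^ (6 * n) * 16 + 2 * 2 ^ (6 * n) * 64 := (abs_add_le _ _).trans (add_le_add h1 h2)
    _ = (160 * n + 128) * (2 : ℚ) ^ (6 * n) := by ring

/-- **`|σ_{n,0}| ≤ (n+1)²(160n+128)·2^{6n}`** — Lemma 5.2's `max_i|σ_{n,i}| ≤ 2^{(3s+6+o(1))n}` at `s = 0`, `i = 0`, with an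
explicit polynomial factor. [cite: Lai2025TwoAdicZeta, Lemma 5.2 (sigma_est)] -/
theorem abs_sigma0_le (n : ℕ) :
    |sigma0 n| ≤ ((n : ℚ) + 1) ^ 2 * ((160 * n + 128) * (2 : ℚ) ^ (6 * n)) := by
  rw [sigma0, abs_neg]
  refine (abs_sum_le_sum_abs _ _).trans ?_
  have h : ∀ k ∈ range (n + 1), |∑ ℓ ∈ range k, Xterm n k ((ℓ : ℚ) + 1 / 4)| ≤
      ((n : ℚ) + 1) * ((160 * n + 128) * (2 : ℚ) ^ (6 * n)) := by
    intro k hk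
    have hkn : k ≤ n := by have := mem_range.1 hk; omega
    refine (abs_sum_le_sum_abs _ _).trans ?_
    refine (sum_le_sum fun ℓ _ => abs_Xterm_le n hkn ℓ).trans ?_
    rw [sum_const, card_range, nsmul_eq_mul]
    refine mul_le_mul_of_nonneg_right ?_ (by positivity)
    have : (k : ℚ) ≤ n := by exact_mod_cast hkn
    linarith
  refine (sum_le_sum h).trans ?_
  rw [sum_const, card_range, nsmul_eq_mul]
  push_cast
  nlinarith [sq_nonneg ((n : ℚ) + 1), show (0 : ℚ) ≤ (160 * n + 128) * 2 ^ (6 * n) by positivity]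

end Literature.NumberTheory.Irrationality.Lai2025TwoAdic
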